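import Literature.MathematicalPhysics.QuantumFieldTheory.ConstructiveQFTWave0WilsonLoopOddProofs
import Literature.MathematicalPhysics.QuantumFieldTheory.LatticeGaugeStaticPotentialLimitProofs
import Summits.QuantumFields.GaugeBoot.WilsonLoopRPMinors
import HarnessLib

/-!
# Crux `IR` (stmt-QuantumFields-19354), line `tension-ratio`: the Seiler–Bachas plaquette lower bound
# `⟨W_{1×1}⟩^{hR} ≤ ⟨W_{h×R}⟩` on the ODD torus (loops in the action's own representation)

Helper module for item `stmt-QuantumFields-19354` (`--supports … --as helper`; it closes nothing).  The line `tension-ratio` types its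
area laws on the ODD tori `2S+1` (`TensionRatio.torusRect`, the cold-pressure currency's tori), while the tree's torus form of Seiler's
a-priori bound, `plaquette_pow_le_wilsonExpectation_wilsonLoopRep` (`TorusWilsonLoopRepGramBounds`, p592927), is stated for EVEN torus
sides only ("the odd torus needs the mixed reflection … and is not treated").  For loops in the SAME representation `ρ` as the Wilson action
the odd-torus Gram inequalities ARE in the tree (`gram_wilsonLoop_nonneg_odd_of_odd` ∕ `gram_wilsonLoop_nonneg_even_of_odd` of
`ConstructiveQFTWave0WilsonLoopOddProofs`: reflection positivity of the odd torus in the hyperplane between time slices and in the site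
hyperplane `t = (L+1)/2`), and this file runs the derivation of p592927 on them:

* `wilsonExpectation_wilsonLoop_nonneg_odd` (`0 ≤ ⟨W_{h×R}⟩`, `h + 2 ≤ L`), `wilsonExpectation_wilsonLoop_sq_le_odd`
  (`⟨W_{(h+1)×R}⟩² ≤ ⟨W_{h×R}⟩⟨W_{(h+2)×R}⟩`, `h + 4 ≤ L` — Bachas' inequality (8) on the odd torus),
* `pow_wilsonExpectation_wilsonLoop_le_odd` (`⟨W_{1×R}⟩^h ≤ ⟨W_{h×R}⟩`, `h + 2 ≤ L`),
* `plaquette_pow_le_wilsonExpectation_wilsonLoop_odd` (`⟨W_{1×1}⟩^{hR} ≤ ⟨W_{h×R}⟩` in the `(0,1)` plane, `h + 2 ≤ L`, `R + 2 ≤ L`, `d ≥ 2`),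

for every compact `G`, continuous `ρ`, `β ≥ 0`, `L` odd, `L ≥ 3` (corner `⟨W_{0×R}⟩ = 1` and axis exchange from `GaugeBoot.WilsonLoopRPMinors`, whose minors are the EVEN-torus ones).  Used by `Theorems/IR/TensionRatioSelf.lean` (the loop floor `LoopFloorSC` and
the registered rung T2-sc for the fundamental loops of special-unitary models, on the line's own odd tori).
HONEST FRAMING: reflection-positivity bookkeeping; no positivity or size of `⟨W_{1×1}⟩` is asserted here; the YM mass gap (Clay) is NOT proved;
`R4` closes only the conditional rung `BalabanLadder.UV`.
Refs: E. Seiler, Phys. Rev. D 18 (1978) 482; C. Bachas, Phys. Rev. D 33 (1986) 2723, eq. (8); E. Seiler, LNP 159 (1982) §2.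
-/

set_option autoImplicit false

noncomputable section

open MeasureTheory Finset
open Literature.MathematicalPhysics.QuantumFieldTheory Literature.MathematicalPhysics.QuantumLattice

namespace Summit.QuantumFields.YangMills.Cruxes.IR.OddTorusRP

variable {d L N : ℕ} {G : Type*} [Group G] [TopologicalSpace G] [IsTopologicalGroup G]
  [CompactSpace G] [MeasurableSpace G] [BorelSpace G] (ρ : G →* Matrix (Fin N) (Fin N) ℂ)

/-! ## §1 The `2 × 2` Gram bookkeeping (`W(0) = 1` is the tree's `GaugeBoot.wilsonExpectation_wilsonLoop_height_zero`) -/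

omit [TopologicalSpace G] [IsTopologicalGroup G] [CompactSpace G] [MeasurableSpace G] [BorelSpace G] in
/-- The `2 × 2` Gram sum over `{a, a+1}` is the quadratic form of its three entries. -/
theorem quad_of_gram_pair {W : ℕ → ℝ} {h : ℕ → ℕ → ℕ} {a p q r : ℕ} {x y : ℝ}
    (hp : h a a = p) (hq : h a (a + 1) = q) (hq' : h (a + 1) a = q) (hr : h (a + 1) (a + 1) = r)
    (hG : 0 ≤ ∑ s ∈ ({a, a + 1} : Finset ℕ), ∑ t ∈ ({a, a + 1} : Finset ℕ),
      (if s = a then x else y) * (if t = a then x else y) * W (h s t)) :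
    0 ≤ W p * x ^ 2 + 2 * W q * x * y + W r * y ^ 2 := by
  have hne : a ≠ a + 1 := by omega
  rw [Finset.sum_pair hne, Finset.sum_pair hne, Finset.sum_pair hne] at hG
  simp only [↓reduceIte, if_neg hne.symm, hp, hq, hq', hr] at hG
  have e : W p * x ^ 2 + 2 * W q * x * y + W r * y ^ 2 =
      x * x * W p + x * y * W q + (y * x * W q + y * y * W r) := by ring
  rw [e]
  exact hG

/-! ## §2 Positivity and log-convexity on the odd torus -/

/-- **Positivity of rectangular loop expectations on the odd torus**: for `L` odd, `L ≥ 3`, `β ≥ 0`, continuous `ρ`, `j ≠ 0`,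
`h + 2 ≤ L` and any `R`, `0 ≤ ⟨W_{h × R}⟩_{Λ_L,β}` (diagonal entries of the two odd-torus Gram matrices). -/
theorem wilsonExpectation_wilsonLoop_nonneg_odd [NeZero d] [NeZero L] (hL : Odd L) (hL3 : 3 ≤ L)
    (hρ : Continuous ρ) {β : ℝ} (hβ : 0 ≤ β) {j : Fin d} (hj : j ≠ 0) {h : ℕ} (hh : h + 2 ≤ L) (R : ℕ) :
    0 ≤ wilsonExpectation ρ β (wilsonLoop ρ (0 : Site d L) 0 j h R) := by
  have hL2 : L / 2 + L / 2 + 1 = L := by obtain ⟨m, rfl⟩ := hL; omega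
  rcases Nat.even_or_odd' h with ⟨a, rfl | rfl⟩
  · have hG := gram_wilsonLoop_nonneg_even_of_odd ρ hL hL3 hρ hβ hj R {a}
      (fun s hs => by rw [Finset.mem_singleton] at hs; omega) (fun _ => 1)
    simpa [two_mul] using hG
  · have hG := gram_wilsonLoop_nonneg_odd_of_odd ρ hL hL3 hρ hβ hj R {a}
      (fun s hs => by rw [Finset.mem_singleton] at hs; omega) (fun _ => 1)
    simpa [two_mul] using hG

/-- **Log-convexity in the time direction on the odd torus** (Bachas' inequality (8)): for `L` odd, `L ≥ 3`, `β ≥ 0`, continuous `ρ`,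
`j ≠ 0`, `h + 4 ≤ L` and any `R`, `⟨W_{(h+1) × R}⟩² ≤ ⟨W_{h × R}⟩ ⟨W_{(h+2) × R}⟩` (the `2 × 2` minors of the two odd-torus Gram matrices). -/
theorem wilsonExpectation_wilsonLoop_sq_le_odd [NeZero d] [NeZero L] (hL : Odd L) (hL3 : 3 ≤ L)
    (hρ : Continuous ρ) {β : ℝ} (hβ : 0 ≤ β) {j : Fin d} (hj : j ≠ 0) {h : ℕ} (hh : h + 4 ≤ L) (R : ℕ) :
    wilsonExpectation ρ β (wilsonLoop ρ (0 : Site d L) 0 j (h + 1) R) ^ 2 ≤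
      wilsonExpectation ρ β (wilsonLoop ρ (0 : Site d L) 0 j h R) *
        wilsonExpectation ρ β (wilsonLoop ρ (0 : Site d L) 0 j (h + 2) R) := by
  have hL2 : L / 2 + L / 2 + 1 = L := by obtain ⟨m, rfl⟩ := hL; omega
  set W : ℕ → ℝ := fun n => wilsonExpectation ρ β (wilsonLoop ρ (0 : Site d L) 0 j n R) with hW
  rcases Nat.even_or_odd' h with ⟨a, rfl | rfl⟩
  · -- `h = 2a`: site hyperplane, heights `{a, a+1}`
    have hq : ∀ x y : ℝ,
        0 ≤ W (a + a) * x ^ 2 + 2 * W (a + a + 1) * x * y + W (a + a + 2) * y ^ 2 := by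
      intro x y
      have hG := gram_wilsonLoop_nonneg_even_of_odd ρ hL hL3 hρ hβ hj R {a, a + 1}
        (fun s hs => by
          rw [Finset.mem_insert, Finset.mem_singleton] at hs
          omega) (fun u => if u = a then x else y)
      exact quad_of_gram_pair (W := W) (h := fun s t => s + t) (a := a) rfl rfl (by omega)
        (by omega) hG
    have := StaticPotential.sq_le_mul_of_forall_quadratic_nonneg hq
    rw [two_mul]
    exact this
  · -- `h = 2a + 1`: hyperplane between time slices, heights `{a, a+1}`
    have hq : ∀ x y : ℝ,
        0 ≤ W (a + a + 1) * x ^ 2 + 2 * W (a + a + 2) * x * y + W (a + a + 3) * y ^ 2 := by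
      intro x y
      have hG := gram_wilsonLoop_nonneg_odd_of_odd ρ hL hL3 hρ hβ hj R {a, a + 1}
        (fun s hs => by
          rw [Finset.mem_insert, Finset.mem_singleton] at hs
          omega) (fun u => if u = a then x else y)
      exact quad_of_gram_pair (W := W) (h := fun s t => s + t + 1) (a := a) rfl rfl (by omega)
        (by omega) hG
    have := StaticPotential.sq_le_mul_of_forall_quadratic_nonneg hq
    rw [two_mul, show a + a + 1 + 1 = a + a + 2 by ring, show a + a + 1 + 2 = a + a + 3 by ring]
    exact this

/-! ## §3 The Seiler–Bachas lower bounds on the odd torus -/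

/-- A non-negative log-convex sequence with `W(0) = 1` dominates the geometric sequence through `W(1)` (zeros allowed), on an
initial segment. -/
theorem pow_le_of_logConvex_nonneg {W : ℕ → ℝ} {K : ℕ} (h0 : W 0 = 1)
    (hnn : ∀ n, n ≤ K → 0 ≤ W n) (hconv : ∀ n, n + 2 ≤ K → W (n + 1) ^ 2 ≤ W n * W (n + 2)) :
    ∀ n, n ≤ K → W 1 ^ n ≤ W n := by
  intro n hn
  rcases n with _ | m
  · simp [h0]
  have h1 : 0 ≤ W 1 := hnn 1 (by omega)
  rcases h1.eq_or_lt with hz | hpos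
  · rw [← hz, zero_pow (Nat.succ_ne_zero m)]
    exact hnn _ hn
  · have key : ∀ n, n + 1 ≤ K → 0 < W n ∧ W 1 * W n ≤ W (n + 1) := by
      intro n
      induction n with
      | zero => intro _; exact ⟨by rw [h0]; exact one_pos, by rw [h0, mul_one]⟩
      | succ n ih =>
        intro hn'
        obtain ⟨hposn, hstep⟩ := ih (by omega)
        have hpos1 : 0 < W (n + 1) := lt_of_lt_of_le (mul_pos hpos hposn) hstep
        refine ⟨hpos1, ?_⟩
        have hc := hconv n (by omega)
        have h3 : W 1 * W (n + 1) * W n ≤ W (n + 2) * W n := by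
          calc W 1 * W (n + 1) * W n = W (n + 1) * (W 1 * W n) := by ring
            _ ≤ W (n + 1) * W (n + 1) := mul_le_mul_of_nonneg_left hstep hpos1.le
            _ = W (n + 1) ^ 2 := (sq _).symm
            _ ≤ W n * W (n + 2) := hc
            _ = W (n + 2) * W n := mul_comm _ _
        exact le_of_mul_le_mul_right h3 hposn
    have main : ∀ k, k + 1 ≤ K → W 1 ^ (k + 1) ≤ W (k + 1) := by
      intro k
      induction k with
      | zero => intro _; simp
      | succ k ih =>
        intro hk
        calc W 1 ^ (k + 1 + 1) = W 1 * W 1 ^ (k + 1) := by ring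
          _ ≤ W 1 * W (k + 1) := mul_le_mul_of_nonneg_left (ih (by omega)) hpos.le
          _ ≤ W (k + 1 + 1) := (key (k + 1) hk).2
    exact main m hn

/-- **`⟨W_{1 × R}⟩^h ≤ ⟨W_{h × R}⟩` on the odd torus** (powers in the time direction): `L` odd, `L ≥ 3`, `β ≥ 0`, continuous `ρ`,
`N ≥ 1`, `j ≠ 0`, `h + 2 ≤ L`. -/
theorem pow_wilsonExpectation_wilsonLoop_le_odd [NeZero d] [NeZero L] (hL : Odd L) (hL3 : 3 ≤ L)
    (hρ : Continuous ρ) {β : ℝ} (hβ : 0 ≤ β) (hN : N ≠ 0) {j : Fin d} (hj : j ≠ 0) {h : ℕ} (hh : h + 2 ≤ L) (R : ℕ) :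
    wilsonExpectation ρ β (wilsonLoop ρ (0 : Site d L) 0 j 1 R) ^ h ≤
      wilsonExpectation ρ β (wilsonLoop ρ (0 : Site d L) 0 j h R) := by
  set W : ℕ → ℝ := fun n => wilsonExpectation ρ β (wilsonLoop ρ (0 : Site d L) 0 j n R) with hW
  have h0 : W 0 = 1 := GaugeBoot.wilsonExpectation_wilsonLoop_height_zero ρ hρ hN β 0 0 j R
  exact pow_le_of_logConvex_nonneg (K := L - 2) h0
    (fun n hn => wilsonExpectation_wilsonLoop_nonneg_odd ρ hL hL3 hρ hβ hj (by omega) R)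
    (fun n hn => wilsonExpectation_wilsonLoop_sq_le_odd ρ hL hL3 hρ hβ hj (by omega) R) h
    (by omega)

/-- **The Seiler–Bachas plaquette lower bound on the ODD torus**: `⟨W_{1 × 1}⟩^{h R} ≤ ⟨W_{h × R}⟩_{Λ_L,β}` for the rectangular loops of the
`(0,1)` plane in the action's representation `ρ`, `L` odd, `L ≥ 3`, `β ≥ 0`, continuous `ρ`, `N ≥ 1`, `h + 2 ≤ L`, `R + 2 ≤ L`, `d ≥ 2`.  In particular an
area law `⟨W_{h×R}⟩ ≤ C^{2(h+R)} e^{−s h R}` on all large odd tori with `⟨W_{1×1}⟩ ≥ w > 0` forces `s ≤ −log w`. -/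
theorem plaquette_pow_le_wilsonExpectation_wilsonLoop_odd [NeZero d] [NeZero L] (hd : 2 ≤ d) (hL : Odd L) (hL3 : 3 ≤ L)
    (hρ : Continuous ρ) {β : ℝ} (hβ : 0 ≤ β) (hN : N ≠ 0) {h R : ℕ} (hh : h + 2 ≤ L) (hR : R + 2 ≤ L) :
    wilsonExpectation ρ β (wilsonLoop ρ (0 : Site d L) 0 1 1 1) ^ (h * R) ≤
      wilsonExpectation ρ β (wilsonLoop ρ (0 : Site d L) 0 1 h R) := by
  have h10 : (1 : Fin d) ≠ 0 := by
    intro h01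
    have := congrArg Fin.val h01
    rw [Fin.val_zero, Fin.val_one', Nat.one_mod_eq_one.mpr (by omega)] at this
    exact one_ne_zero this
  have hP : 0 ≤ wilsonExpectation ρ β (wilsonLoop ρ (0 : Site d L) 0 1 1 1) :=
    wilsonExpectation_wilsonLoop_nonneg_odd ρ hL hL3 hρ hβ h10 (h := 1) (by omega) 1
  -- width direction: `W(1,1)^R ≤ W(R,1) = W(1,R)`
  have hwidth : wilsonExpectation ρ β (wilsonLoop ρ (0 : Site d L) 0 1 1 1) ^ R ≤
      wilsonExpectation ρ β (wilsonLoop ρ (0 : Site d L) 0 1 1 R) := by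
    rw [GaugeBoot.wilsonExpectation_wilsonLoop_comm hρ β h10 1 R]
    exact pow_wilsonExpectation_wilsonLoop_le_odd ρ hL hL3 hρ hβ hN h10 hR 1
  -- time direction: `W(1,R)^h ≤ W(h,R)`
  calc wilsonExpectation ρ β (wilsonLoop ρ (0 : Site d L) 0 1 1 1) ^ (h * R)
      = (wilsonExpectation ρ β (wilsonLoop ρ (0 : Site d L) 0 1 1 1) ^ R) ^ h := by
        rw [mul_comm, pow_mul]
    _ ≤ wilsonExpectation ρ β (wilsonLoop ρ (0 : Site d L) 0 1 1 R) ^ h :=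
        pow_le_pow_left₀ (pow_nonneg hP R) hwidth h
    _ ≤ wilsonExpectation ρ β (wilsonLoop ρ (0 : Site d L) 0 1 h R) :=
        pow_wilsonExpectation_wilsonLoop_le_odd ρ hL hL3 hρ hβ hN h10 hh R

end Summit.QuantumFields.YangMills.Cruxes.IR.OddTorusRP

end
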